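import Literature.NumberTheory.Transcendental.RoyRankGenericKernels
import Literature.NumberTheory.Transcendental.RoyRankGenericThm4
import Literature.Barriers.Schanuel.AlgebraicIndependenceOfLogarithmsRoyThm2bis
import HarnessLib

/-!
# Roy 1992 over a general field: Theorem 2 PROVED from Theorem 1, and Theorem 4 from Theorem 1

Assembly file (theorems only) of the field-generic rendering of [Roy1992] over the data
`(K, F, L, ω)` of `Literature.NumberTheory.Transcendental.RoyRankGenericDefs`:

* `RoyRank.thm2_of_thm1 : Thm1 F L ω → Thm2 F L ω` — **Theorem 2 from Theorem 1**, following the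
  printed proof: in Roy's category `𝒞` (§2; `royCat prop1_ker prop1_coker`, Propositions 1–3 of
  `…RoyRankGenericKernels`) Theorem 1 is Statement 1 of Theorem 3 (`Obj.statement1_of_thm1`), so
  Theorem 3 gives Statement 2′ and Theorem 2bis — the tree's ABSTRACT
  `Literature.Barriers.Schanuel.Roy1992.AdmissibleCat.thm2bis` (proved there for any admissible
  category from Roy's Theorem 3, `…RoyThm3`), imported — which is Theorem 2 once the cokernels of
  `𝒞` are read as the admissible maps `s`, the ratio `d₁(X')/b(X')` as `d₁'/(d₀' + d₁' − dim_K(s(V)))`,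
  and the kernel condition as `s(V) ∩ (F^{d₀'} × 0) = 0` (`Obj.IsCokerMap.isThm2Minimal_iff`,
  `Obj.noBadKernel_iff`). Field-generic form of the tree's `roy1992_thm2_of_thm1` (`K = ℂ`).
* `RoyRank.thm4_of_thm1 : Thm1 F L ω → (F algebraic over ℚ) → Thm4 F L` — the whole chain below
  Theorem 1 (with `…RoyRankGenericThm4`).

So, over any field `K` of characteristic `0`, subfield `F ⊆ K` algebraic over `ℚ`, `ℚ`-subspace
`L ⊆ K` and `ω ∈ K`, Roy's Theorem 4 for `(K, F, F + F·L)` follows from Waldschmidt's Theorem 1 for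
`(K, F, L, ω)`; the `p`-adic instance is drawn in a companion of
`Literature.NumberTheory.Transcendental.RoyPadicRank`.

## References

* [Roy1992] D. Roy, *Matrices whose coefficients are linear forms in logarithms*, J. Number Theory
  41 (1992) 22–47: §1 Theorems 1–2 (p. 25); §2 Theorem 2bis (p. 27); §3 proof of Theorem 2bis
  (pp. 32–34); §4 Theorem 4 (p. 34), Remark (i) (p. 37).
* [Waldschmidt1988] M. Waldschmidt, *On the transcendence methods of Gel'fond and Schneider in
  several variables*, New Advances in Transcendence Theory (1988), Thm 4.1 (the source of Theorem 1).
-/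

noncomputable section

open Module Submodule
open Literature.Barriers.Schanuel.Roy1992 (AdmissibleCat)

namespace Literature.NumberTheory.Transcendental.RoyRank

variable {K : Type*} [Field K] [CharZero K]
variable {F : IntermediateField ℚ K} {L : Submodule ℚ K} {ω : K}

/-- **Roy 1992, Theorem 2 from Theorem 1 over the data `(K, F, L, ω)`**
(`Thm1 F L ω → Thm2 F L ω`), following the printed proof (§§2–3): Theorem 1 is Statement 1 of
Theorem 3 for `(𝒞, a, b, c, d, r)`; Theorem 3 and Theorem 2bis (abstract, in the tree) give the
conclusion, read back through `isThm2Minimal_iff` and `noBadKernel_iff`.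
[cite: Roy1992, §1 Theorem 2 (p. 25); §2 Theorem 2bis (p. 27); §3 proof of Theorem 2bis (pp. 32–34)] -/
theorem thm2_of_thm1 (h : Thm1 F L ω) : Thm2 F L ω := by
  intro d₀ d₁ Y W V hfin hlog hrat hYV hWV hV
  let X : Obj F L := ⟨d₀, d₁, Y, W, V, hfin, hlog, hrat, hYV, hWV⟩
  have hb : fb X ≠ 0 := (Obj.fb_ne_zero_iff X).2 hV
  obtain ⟨⟨X', ⟨⟨s, hs⟩, hb', hmin⟩, hno⟩, hall⟩ :=
    AdmissibleCat.thm2bis (𝒞 := royCat (F := F) (L := L) Obj.prop1_ker Obj.prop1_coker)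
      (Obj.thm3Hyp ω) Obj.fd₁_additive (fun X => Obj.fa_le_fd₁ X ω) (Obj.prop3 ω)
      (Obj.statement1_of_thm1 h) X hb
  refine ⟨⟨X'.d₀, X'.d₁, s, ?_, ?_⟩, ?_⟩
  · exact hs.isThm2Minimal_iff.2 ⟨hb', fun X'' s'' hs'' hb'' => hmin X'' ⟨s'', hs''⟩ hb''⟩
  · have hV' : V.map s = X'.V := hs.2.2.2.symm
    rw [hV']
    refine (Obj.noBadKernel_iff X').1 ?_
    rintro ⟨A, i, hi, h1, h2, h3⟩
    exact hno ⟨A, ⟨i, hi⟩, h1, h2, h3⟩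
  · intro d₀' d₁' s hmin htriv
    have hbr : IsBiRational F s := hmin.1.2
    have hsc : X.IsCokerMap (X.mapObj s hbr) s := X.isCokerMap_mapObj hmin.1
    obtain ⟨hb', hmin'⟩ := hsc.isThm2Minimal_iff.1 hmin
    have hno : ¬ ∃ A, (royCat (F := F) (L := L) Obj.prop1_ker Obj.prop1_coker).IsKer A
        (X.mapObj s hbr) ∧ fd₁ A = 0 ∧ fb A = 0 ∧ fr A ≠ 0 := by
      rintro ⟨A, ⟨i, hi⟩, h1, h2, h3⟩
      exact (Obj.noBadKernel_iff (X.mapObj s hbr)).2 htriv ⟨A, i, hi, h1, h2, h3⟩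
    obtain ⟨hle1, hle2⟩ := hall (X.mapObj s hbr) ⟨s, hsc⟩ hb'
      (fun X'' ⟨s'', hs''⟩ hb'' => hmin' X'' s'' hs'' hb'') hno
    rw [← Obj.thm2Ratio_eq hsc] at hle1 hle2
    refine ⟨?_, ?_⟩
    · rw [Obj.cast_fb_add_fd] at hle1
      exact hle1
    · rw [Obj.cast_fa, Obj.cast_fb] at hle2
      exact hle2

/-- **The whole chain below Theorem 1, over the data `(K, F, L, ω)`**: `Thm1 F L ω → Thm4 F L` for
`F` algebraic over `ℚ` (Theorem 4 from M. Waldschmidt's theorem, via Theorem 2).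
[cite: Roy1992, §4 Theorem 4 (p. 34) and Remark (i) (p. 37)] -/
theorem thm4_of_thm1 (h : Thm1 F L ω) (hF : ∀ x : K, x ∈ F → IsAlgebraic ℚ x) : Thm4 F L :=
  thm4_of_thm2 (thm2_of_thm1 h) hF

end Literature.NumberTheory.Transcendental.RoyRank
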